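import Mathlib
import Literature.Computability.Complexity.CliqueTestGraphs
import Summits.PneNP.PneNP.Theorems.ConvexRankGatesConvexGateBlindStrictRankCore
import Summits.PneNP.PneNP.Theorems.ConvexRankGatesConvexGateBlindCanonicalForm
import Summits.PneNP.PneNP.Theorems.ConvexRankGatesConvexGateBlindCliqueDistanceConverse

/-!
# PneNP / ConvexRankGates — `ConvexGateBlind` in ε-free (strict-rank) form

Helpers (`--supports stmt-PneNP-10680`): the crux and its LP slice with the limit `ε → 0` removed, composing the
matrix-level equivalences of `…StrictRankCore.lean` with the canonical forms
(`convexGateBlind_iff_cliqueDistConeRankHard`, `cliqueDist_rankHard_iff_lpDataHard`).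

* `convexGateBlind_iff_strictConeRankHard` — `ConvexGateBlind ↔ ∃ δ ∈ (0,1/2), ∀ c, ∀ᶠ m, ∀ q r, q + r ≤ m^c →` there are
  NO `H_u ⪰ 0`, `Y_Q ⪰ 0` (`q × q`), `U, V ≥ 0` (`r` terms) and POSITIVE `a_u, b_Q` with
  `D[Q,u] = tr(H_u Y_Q) + ∑_l U_{u,l} V_{l,Q} + a_u b_Q` (`D[Q,u] = #(E(Q) ∖ u)`): for every entrywise-positive rank-one
  `a ⊗ b ≤ D` the `(PSD ⊕ ℝ_{≥0})`-rank of `D - a ⊗ b` is superpolynomial — one integer matrix, one positive rank-one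
  matrix, no limit.
* `lpDataHard_iff_strictRankHard` — the LP data form of the crux (for a given `δ`) iff `rk₊₊(D) > m^c` eventually for every
  `c`: the distance profiles of the clique-free graphs do not lie in the cone of polynomially many strictly positive
  clique-functions — Hrubeš's Open Problem 4 for the explicit matrix `D` (whose `rk₊` is `≤ #E`), Open Problem 3 for
  `f = CLIQUE`.
[folklore; Hrubeš 2020 (`Hrubes2020`, ECCC TR19-034), Lemma 16, Proposition 17, Theorem 20, Open Problems 3–4]
-/

namespace Summit.PneNP.PneNP.Theorems

open Matrix Finset Literature.Computability.Complexity

/-- **`ConvexGateBlind` in strict (ε-free) form.** The crux holds iff for some `δ ∈ (0,1/2)` and every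
`c`, eventually in `m`, the one-sided clique-distance matrix `D` of `CLIQUE(m, ⌈m^δ⌉₊)` has no factorisation
`D[Q,u] = tr(H_u Y_Q) + ∑_{l<r} U_{u,l} V_{l,Q} + a_u b_Q` with `H_u, Y_Q ⪰ 0` (`q × q`), `U, V ≥ 0`, `a, b > 0`
entrywise and `q + r ≤ m^c` — equivalently, `D - a ⊗ b` has superpolynomial `(PSD ⊕ ℝ_{≥0})`-rank for EVERY
positive rank-one `a ⊗ b ≤ D`. No limit `ε → 0` remains. [folklore; Hrubeš 2020 (`Hrubes2020`), Prop. 17] -/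
theorem convexGateBlind_iff_strictConeRankHard :
    Summit.PneNP.PneNP.Theses.ConvexRankGates.ConvexGateBlind ↔
    (∃ δ : ℝ, 0 < δ ∧ δ < 1 / 2 ∧ ∀ c : ℕ, ∀ᶠ m : ℕ in Filter.atTop, ∀ (q r : ℕ), q + r ≤ m ^ c →
      ∀ (H : ((⊤ : SimpleGraph (Fin m)).edgeSet → Bool) → Matrix (Fin q) (Fin q) ℝ) (Y : Finset (Fin m) → Matrix (Fin q) (Fin q) ℝ)
        (U : ((⊤ : SimpleGraph (Fin m)).edgeSet → Bool) → Fin r → ℝ) (V : Fin r → Finset (Fin m) → ℝ)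
        (a : ((⊤ : SimpleGraph (Fin m)).edgeSet → Bool) → ℝ) (b : Finset (Fin m) → ℝ),
        (∀ u, cliqueFn m ⌈(m : ℝ) ^ δ⌉₊ u = false → (H u).PosSemidef) →
        (∀ Q : Finset (Fin m), Q.card = ⌈(m : ℝ) ^ δ⌉₊ → (Y Q).PosSemidef) →
        (∀ u l, 0 ≤ U u l) → (∀ l Q, 0 ≤ V l Q) →
        (∀ u, cliqueFn m ⌈(m : ℝ) ^ δ⌉₊ u = false → 0 < a u) →
        (∀ Q : Finset (Fin m), Q.card = ⌈(m : ℝ) ^ δ⌉₊ → 0 < b Q) →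
        ¬ ∀ (Q : Finset (Fin m)) (u : (⊤ : SimpleGraph (Fin m)).edgeSet → Bool), Q.card = ⌈(m : ℝ) ^ δ⌉₊ → cliqueFn m ⌈(m : ℝ) ^ δ⌉₊ u = false →
            (∑ e, if cliqueVec Q e = true ∧ u e = false then (1 : ℝ) else 0) =
              (H u * Y Q).trace + ∑ l, U u l * V l Q + a u * b Q) := by
  rw [convexGateBlind_iff_cliqueDistConeRankHard]
  exact exists_congr fun δ => and_congr_right fun _ => and_congr_right fun _ =>
    cliqueDistConeRankHard_iff_strictConeRankHard δ

/-- **The LP slice of the crux as Hrubeš's Open Problem 4 for the clique-distance matrix.** The LP data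
form of `ConvexGateBlind` (for a given `δ`: eventually no LP-feasibility data `∃ z ≥ 0, Az ≤ b + B·1_x`,
`B ≥ 0`, `p + q ≤ m^c`, compute `CLIQUE(m, ⌈m^δ⌉₊)`) holds iff for every `c`, eventually, the distance
profiles `Q ↦ #(E(Q) ∖ u)` of the `⌈m^δ⌉₊`-clique-free graphs `u` do not all lie in the cone generated by
`r ≤ m^c` functions that are strictly positive on the `⌈m^δ⌉₊`-sets (`rk₊₊(D) > m^c`). [folklore; Hrubeš 2020
(`Hrubes2020`), Lemma 16, Proposition 17, Theorem 20, Open Problems 3–4] -/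
theorem lpDataHard_iff_strictRankHard (δ : ℝ) :
    (∀ c : ℕ, ∀ᶠ m : ℕ in Filter.atTop, ∀ (p q : ℕ), p + q ≤ m ^ c →
      ∀ (A : Fin p → Fin q → ℝ) (b : Fin p → ℝ) (B : Fin p → (⊤ : SimpleGraph (Fin m)).edgeSet → ℝ), (∀ i e, 0 ≤ B i e) →
        ¬ ∀ x : (⊤ : SimpleGraph (Fin m)).edgeSet → Bool, cliqueFn m ⌈(m : ℝ) ^ δ⌉₊ x = true ↔
          ∃ z : Fin q → ℝ, (∀ j, 0 ≤ z j) ∧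
            ∀ i, ∑ j, A i j * z j ≤ b i + ∑ e, B i e * (if x e then (1 : ℝ) else 0)) ↔
    (∀ c : ℕ, ∀ᶠ m : ℕ in Filter.atTop, ∀ r : ℕ, r ≤ m ^ c →
      ∀ (lam : ((⊤ : SimpleGraph (Fin m)).edgeSet → Bool) → Fin r → ℝ) (g : Fin r → Finset (Fin m) → ℝ),
        (∀ u l, 0 ≤ lam u l) → (∀ l (Q : Finset (Fin m)), Q.card = ⌈(m : ℝ) ^ δ⌉₊ → 0 < g l Q) →
        ¬ ∀ (Q : Finset (Fin m)) (u : (⊤ : SimpleGraph (Fin m)).edgeSet → Bool), Q.card = ⌈(m : ℝ) ^ δ⌉₊ →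
            cliqueFn m ⌈(m : ℝ) ^ δ⌉₊ u = false →
              (∑ e, if cliqueVec Q e = true ∧ u e = false then (1 : ℝ) else 0) = ∑ l, lam u l * g l Q) :=
  (cliqueDist_rankHard_iff_lpDataHard δ).symm.trans (cliqueDist_rankHard_iff_strictRankHard δ)

end Summit.PneNP.PneNP.Theorems
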